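import Summits.QuantumAdvantage.AdviceFreeQNC0.WalkHardFLinForms
import HarnessLib

/-!
# Rung R11 `WalkHardFLinTests p` (Boolean linear TESTS mod `p`) — PROVED for every prime `p ≠ 3`

Planner qa-qnc0-p2 g15, ROUND-15 (p2) §3.11 (def VERBATIM from `line15/Sketch15R7.lean`): a strategy reading the input ONLY through
`K ≤ (log₂ n)^C` linear tests `[Σ_i λ_{j,i} u_i mod p ∈ A_j]` (arbitrary coefficients and accepting sets) and then firing an arbitrary
table of cuts per test outcome wins on at most `θ·2ⁿ` inputs.  Special case of R11' `WalkHardFLinForms` (the table indexed by the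
residue vector factors through the test vector; p2's certificate), proved in `WalkHardFLinForms.lean`.
WHAT THIS IS NOT: false for `p = 3`; rung F-Q2-odd instrument; separation NOT moved.
-/

noncomputable section

namespace Summit.QuantumAdvantage.AdviceFreeQNC0

open Finset

/-- **`WalkHardFLinTests p`** (rung R11; planner qa-qnc0-p2 g15 Sketch15R7, verbatim): a strategy that reads the input ONLY through
`K ≤ (log₂ n)^C` linear tests `[Σ_i λ_{j,i} u_i mod p ∈ A_j]` (arbitrary coefficients — dense, high fan-in — and accepting sets)
and then fires an ARBITRARY table of cuts per test outcome wins on at most `θ·2ⁿ` inputs. -/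
def WalkHardFLinTests (p : ℕ) [Fact p.Prime] : Prop :=
  ∃ θ : ℝ, θ < 1 ∧ ∀ C : ℕ, ∃ n₀ : ℕ, ∀ n ≥ n₀, ∀ c K : ℕ, K ≤ (Nat.log 2 n) ^ C →
    ∀ lam : Fin K → Fin n → ZMod p, ∀ A : Fin K → Finset (ZMod p),
    ∀ tab : Fin (n + 1) → (Fin K → Bool) → Bool,
      ((Finset.univ.filter fun u : Fin n → Bool =>
          ringWinU c (fun g v => tab g fun j => decide ((∑ i, if v i then lam j i else 0) ∈ A j)) u = true).card : ℝ)
        ≤ θ * (2 : ℝ) ^ n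

/-- R11' implies R11 (planner certificate): the Boolean-test table factors through the residue vector. -/
theorem walkHardFLinTests_of_linForms (p : ℕ) [Fact p.Prime] (h : WalkHardFLinForms p) : WalkHardFLinTests p := by
  obtain ⟨θ, hθ, H⟩ := h
  refine ⟨θ, hθ, fun C => ?_⟩
  obtain ⟨n₀, hn₀⟩ := H C
  refine ⟨n₀, fun n hn c K hK lam A tab => ?_⟩
  exact hn₀ n hn c K hK lam (fun g r => tab g (fun j => decide (r j ∈ A j)))

/-- **Rung R11 — PROVED for every prime `p ≠ 3`.** -/
theorem walkHardFLinTests (p : ℕ) [Fact p.Prime] (hp3 : p ≠ 3) : WalkHardFLinTests p :=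
  walkHardFLinTests_of_linForms p (walkHardFLinForms p hp3)

end Summit.QuantumAdvantage.AdviceFreeQNC0

end
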